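import Literature.Probability.Percolation.Isoradial
import Literature.Probability.LatticeModels.IsoradialSquareGrid
import HarnessLib

/-!
# Grimmett–Manolescu universality of the one-arm exponent: the printed square-grid hypothesis

Topic `Literature/Probability/Percolation`; companion of `Isoradial.lean`, which vendors
Grimmett–Manolescu, *Bond percolation on isoradial graphs: criticality and universality*,
PTRF 159 (2014) 273–327 = arXiv:1204.0505, §3, Theorem "Universality" (a) for `π = ρ` as the
named fact `gm_universality_oneArm`. Everything in this file is PROVED (no `sorry`, no new
named fact, D-0026); it records the outcome of the `provefact` unit for that fact
(2026-08-15): **misstated — stated stronger than its source**, and writes the corrected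
statement out as the (type-checked) conclusion of `gm_universality_oneArm.toGM`.

**Status (later on 2026-08-15).** The verdict has been acted upon: `gm_universality_oneArm`
was *restated in place* (verdict clean-up of `Isoradial.lean`; human ruling "restate, keep the
name when the correction sharpens hypotheses") and its body is now the corrected statement
below — printed square-grid property `HasSquareGridPropertyGM` for `G` and for the witness
`G₀`, `Countable V` and `G.LocallyFinite` bound explicitly. This file is kept as the record of
the discrepancy of the *original* transcription (what "the def" refers to in the next section
is that original body, quoted in the `History` paragraph of the fact's docstring), and
`gm_universality_oneArm.toGM` is since then the unfolding of the fact.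

## The discrepancy

`gm_universality_oneArm G emb ε` hypothesises, for the graph `G` and (inside its hypothesis)
for the witness `G₀`, the H21 rendering `RhombicEmbedding.HasSquareGridProperty` of the
square-grid property. The tree records (docstring of that predicate in `IsoradialGraphs`;
module docstring of `Literature.Probability.LatticeModels.IsoradialSquareGrid`, with a
separating rhombic tiling having bounded angles: the tiling by unit squares with one extra
staircase track) that this rendering is *strictly weaker* than the property SGP(I) printed in
§4.2 of the source: "the track-set `𝒯` may be partitioned into three sets `𝒯 = S ∪ T₁ ∪ T₂`"
with (a) `T_k = (t_k^i : i ∈ ℤ)` distinct non-intersecting tracks, **(b) for `k = 1, 2` and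
every `s ∈ 𝒯 ∖ T_k`, every track of `T_k` intersects `s`, in index order**, (c) fewer than `I`
track-intersections on `s ∈ T_{3-k}` between `t_k^i` and `t_k^{i+1}`; the H21 rendering drops
(b). The source's class is `𝒢 = ⋃_{ε, I} 𝒢(ε, I)`, `𝒢(ε, I)` = BAP(ε) ∧ SGP(I) (§4.2, last
paragraph), and its proof of universality uses (b): §8.4 begins "let `(s_j)`, `(t_i)` be two
families of tracks forming a square grid of `G` … write `(r_i : i ∈ ℤ)` for the sequence of
all tracks other than the `s_j`, indexed and oriented according to their intersections with
`s_0`", and the comparison isoradial square lattice `G_{α,β}` is built from the transverse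
angles of *all* the `r_i`, "since each `r_i` intersects each `s_j`". Replacing SGP by the
weaker rendering enlarges the class both where it is concluded about (`G`) and where it is
assumed to contain a witness (`G₀`); each replacement makes the statement logically stronger
than what is printed, and for the extra graphs nothing is published. The faithful predicate is
in the tree: `RhombicEmbedding.HasSquareGridPropertyGM` (`∃ I, SquareGridPropertyGM I`).

A second, harmless, elaboration detail: the section instances `[Countable V]`,
`[G.LocallyFinite]` of `Isoradial.lean` are *not* hypotheses of `gm_universality_oneArm` as
elaborated (Lean omits unused instance variables from a definition; checked:
`gm_universality_oneArm G emb ε` elaborates with no such instances in scope), although the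
module docstring there intends them "as standing hypotheses of the class"; for the witness
`G₀` they are explicit. The corrected statement below makes them genuine hypotheses on `G`
(isoradial graphs are locally finite countable planar graphs in the source, §2.1, §4.1).

## The corrected statement (conclusion of `gm_universality_oneArm.toGM`)

Verbatim the original `gm_universality_oneArm` with `HasSquareGridPropertyGM` for
`HasSquareGridProperty` at both occurrences and `Countable V`, `G.LocallyFinite` as
hypotheses. It was not vendored here as a `def … : Prop` (a proving seat may not add an
unproved named fact, D-0026); it has since become the body of `gm_universality_oneArm` itself
(status paragraph above; the sibling `gm_boxCrossingBounds_uniform` was corrected likewise, see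
`IsoradialPrintedBXP`). The same square-grid caveat still applies to the sibling facts
`gm_boxCrossing`, `gm_theta_critical_eq_zero`, `gm_universality_arms` of `Isoradial.lean`.

Rendering notes carried over (not defects). (1) The source defines "`ρ₁` exists for `G`" by
`P_G[A_1^v(N, n)] ≈ n^{-ρ₁}` (log-equivalence) *uniformly in the vertex `v`*, with a fixed
large inner radius `N` (§3); the tree's rendering is `HasDecayExponent` of the origin-centred
event `embOneArm` (inner box `Λ_2`, slack `2`). For `G ∈ 𝒢(ε, I)` the two agree and the
rendered implication follows from the source: §8.1, Proposition (exp_transport) gives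
`c₁ P_{ℤ²}[A_k(N, n)] ≤ P_G[A_k^u(N, n)] ≤ c₂ P_{ℤ²}[A_k(N, n)]` for `N ≥ N₀(k, ε, I)`,
`n ≥ c₀ N`, uniformly in `G ∈ 𝒢(ε, I)` and in the vertex `u` of `G^◇` ("part (a) of the
universality theorem is an immediate consequence"); with Proposition (exp_equiv) (changing `N`
or `n` by a factor `2` costs a bounded factor) and the FKG/box-crossing gluing of a vertex in
`Λ_2` (the rhombi cover the plane) to `∂Λ_N`, the sequence `P_G(embOneArm emb.z n)` is
comparable, up to constant factors and bounded shifts of `n`, with `P_{ℤ²}[A_1(N, n)]` for every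
`G ∈ 𝒢`, and log-ratio limits are insensitive to both — this last, purely analytic, step of the
printed proof is `Literature.Probability.LatticeModels.HasDecayExponent.of_comparable_of_comparable`
(`CorrelationDecayProofs`: two sequences each two-sided comparable, with constants and a bounded
shift of the scale, with a common eventually positive reference sequence share their decay
exponents). (2) `ε`, `I` may differ between `G` and `G₀`. (3) Size: proving either form needs
the box-crossing property over all of `𝒢` (Thm 3.1 of the source, §§5–7) and the arm-event
transport of §8 (Proposition (exp_transport) itself) — a theory; triaged XL, not attempted.

## References

* G. R. Grimmett, I. Manolescu, *Bond percolation on isoradial graphs: criticality and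
  universality*, PTRF 159 (2014) 273–327 (arXiv:1204.0505): §3 (Theorem "Universality" (a);
  definition of the arm exponents, uniform in `v`), §4.2 (track systems, SGP(I), `𝒢(ε, I)`),
  §8.1 (Proposition (exp_transport)), §8.2 (Proposition (exp_equiv)), §8.4 (use of (b)).
-/

noncomputable section

namespace Literature.Probability.Percolation

open LatticeModels Percolation

variable {V F : Type*} [DecidableEq V] [DecidableEq F] (G : SimpleGraph V)
  (emb : RhombicEmbedding G F) (ε : ℝ)

/-- **The original transcription implies the printed-hypothesis statement** (since the
in-place restatement of `gm_universality_oneArm`, 2026-08-15, hypothesis and conclusion agree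
and this is an unfolding; the text below describes the original situation). The conclusion of
this theorem is Grimmett–Manolescu's universality of the one-arm exponent (§3, Theorem
"Universality" (a), `π = ρ = 1/ρ₁`) in the tree's rendering but with the square-grid property
**as printed** (`RhombicEmbedding.HasSquareGridPropertyGM`, §4.2: `∃ I`, SGP(I) with clauses
(a)–(c)) for both the graph `G` and the witness `G₀`, and with `Countable V`,
`G.LocallyFinite` as genuine hypotheses: *if for some connected isoradial graph `G₀`
(rhombic tiling) with BAP(ε₀) and SGP the one-arm probability satisfies
`P_{G₀}(Λ_2 ↔ ∂Λ_n) = n^{-α + o(1)}`, then so does `P_G` for every such `G`, with the same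
`α`.* It followed from the original `gm_universality_oneArm G emb ε` by
`RhombicEmbedding.HasSquareGridPropertyGM.hasSquareGridProperty` (printed SGP ⇒ H21 rendering)
applied to `G` and to `G₀` — which pinned down the direction of the discrepancy recorded in the
module docstring: the original transcription was the *stronger* statement; the converse
implication was not available. (Grimmett–Manolescu 2014, §3 Theorem "Universality" (a); §4.2.)
[cite: GrimmettManolescu2014Isoradial, §3 Theorem "Universality" (a), π = ρ; §4.2 SGP(I)] -/
theorem gm_universality_oneArm.toGM (h : gm_universality_oneArm G emb ε) :
    ∀ (_ : Countable V) (_ : G.LocallyFinite) (_ : G.Preconnected) (_ : emb.IsIsoradial)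
      (_ : emb.IsRhombicTiling) (_ : 0 < ε) (_ : emb.HasBoundedAngles ε)
      (_ : emb.HasSquareGridPropertyGM) (α : ℝ)
      (_ : ∃ (V₀ F₀ : Type) (_ : Countable V₀) (_ : DecidableEq V₀) (_ : DecidableEq F₀)
        (G₀ : SimpleGraph V₀) (_ : G₀.LocallyFinite) (emb₀ : RhombicEmbedding G₀ F₀) (ε₀ : ℝ),
        G₀.Preconnected ∧ emb₀.IsIsoradial ∧ emb₀.IsRhombicTiling ∧ 0 < ε₀ ∧
          emb₀.HasBoundedAngles ε₀ ∧ emb₀.HasSquareGridPropertyGM ∧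
          HasDecayExponent (fun n => emb₀.isoradialPercolation.real (embOneArm emb₀.z n)) α),
      HasDecayExponent (fun n => emb.isoradialPercolation.real (embOneArm emb.z n)) α :=
  -- since the in-place restatement of `gm_universality_oneArm` (2026-08-15) the conclusion is
  -- the fact unfolded, up to the annotation of the two instance binders
  fun hV hG => @h hV hG

end Literature.Probability.Percolation
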